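import Literature.Probability.Percolation.SmirnovSeparatingData
import Literature.Probability.Percolation.SmirnovTheoremProofs
import Literature.Probability.Percolation.SmirnovReflection
import Literature.Probability.Percolation.TriApproxDomain
import Literature.Probability.Percolation.SmirnovDiscreteCauchy
import Literature.Probability.Percolation.TriAnnulusCrossingProofs
import Literature.Probability.Percolation.IsoradialProofs
import Literature.Topology.PlaneTopology.JordanCurveProofs
import HarnessLib

/-!
# Cardy's formula: conformal invariance of the crossing limit, reduced to the discrete input

Topic `Literature/Probability/Percolation`; sibling proof file of `CardyFormula.lean`.

The named fact `Literature.Probability.Percolation.tendsto_triDomainCrossingProb_of_crossRatio_eq` of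
`CardyFormula.lean` is the corollary of Smirnov's theorem (**crit-perc.S03**,
`hasCrossingLimit_triDomainCrossingProb`) stating that the scaling limit of the critical
site-percolation crossing probability of a conformal rectangle on `δ𝕋` exists and is a conformal
invariant: two conformal rectangles with uniformizing data of the same cross-ratio
(equivalently — Bollobás–Riordan 2006, Ch. 7, p. 161 — conformally equivalent as 4-marked
domains) have the same limit (Smirnov, C. R. Acad. Sci. Paris 333 (2001), Thm. 1 and Cor.;
long version arXiv:0909.4499, Cor. 2, p. 5: "As `δ → 0`, the crossing probability tends to
`h_{τ²}(x)`, and hence is conformally invariant"; Bollobás–Riordan, *Percolation* (2006), Ch. 7,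
Thm. 2, p. 165: "`P(D₄) = lim_{δ→0} P_δ(D₄, T)` exists and is given by Cardy's formula").

Even for `R = R'` the fact asserts the *existence* of the limit, i.e. the first half of
Bollobás–Riordan's Thm. 2, so it has no proof avoiding Smirnov's theorem. `CardyFormula.lean`
already proves it from crit-perc.S03 (`tendsto_triDomainCrossingProb_of_crossRatio_eq_of_hasCrossingLimit`),
and crit-perc.S03 has been reduced in `SmirnovTheorem.lean`, `SmirnovContinuumLimit.lean`,
`SmirnovContinuumLimitProofs.lean`, `SmirnovConformalProofs.lean`, `CardyCarleson.lean`,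
`SmirnovTheoremProofs.lean` and `SmirnovSeparatingData.lean` to the single named fact **(D′)**
`smirnov_exists_separatingData` (the discrete separating data of Bollobás–Riordan (9), Lemma 13,
Lemma 14 and the proof of Claims 22–23) together with the Jordan curve theorem, which is now
PROVED (`Literature.Topology.PlaneTopology.JordanCurveTheorem_holds`, `Literature/Topology/PlaneTopology/JordanCurveProofs.lean`).
This file records the resulting one-hypothesis reduction

* `tendsto_triDomainCrossingProb_of_crossRatio_eq_of_separatingData (hD : smirnov_exists_separatingData)`,

through `hasCrossingLimit_triDomainCrossingProb_of_separatingData` (crit-perc.S03 from (D′)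
alone) and `exists_tendsto_triDomainCrossingProb_of_separatingData` (existence of the limit in
`[0, 1]` from (D′) alone); the discharge `tendsto_triDomainCrossingProb_of_crossRatio_eq_holds`
is to be appended here once (D′) is discharged.

## The current frontier of crit-perc.S03 (five named facts of the discrete theory)

Since then (D′) itself has been decomposed (`TriDiscreteDomain.lean`, `TriApproxDomain.lean`,
`SmirnovReflection.lean`): for conformal rectangles with an anticlockwise Carleson datum it
follows (`smirnov_separatingData_of_discreteApprox`) from Lemma 14 with (19)
(`tri_exists_discreteApprox`), Lemma 13 (`tri_discreteCauchy`), the estimate of the proof of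
Claim 22 (`tri_sepProb_sub_le_of_dualPath`), the estimates of the proof of Claim 23
(`tri_sepProb_boundary_tendsto`) and (40) (`tri_openCrossingProb_approx_sepProb`), the clockwise
case being the complex conjugate (`smirnov_exists_separatingData_of_anticlockwise`); and
Lemma 13 and the estimate of Claim 22 are proved (`SmirnovDiscreteCauchy.lean`:
`tri_discreteCauchy_of_facts`, `tri_sepProb_sub_le_of_dualPath_of_facts`) from Lemma 4 — now
PROVED, `tri_annulusCrossing_bound_holds` (`TriAnnulusCrossingProofs.lean`) — Claim 10
(`tri_sepEvent_diff_subset_arms`) and Lemma 12 (`tri_sepDiffProb_rotate`). This file records the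
resulting assembly: (D′), crit-perc.S03 and the conformal invariance of the crossing limit from
the **five remaining named facts** `tri_exists_discreteApprox`,
`tri_openCrossingProb_approx_sepProb`, `tri_sepProb_boundary_tendsto`,
`tri_sepEvent_diff_subset_arms`, `tri_sepDiffProb_rotate`
(`smirnov_exists_separatingData_of_facts`, `hasCrossingLimit_triDomainCrossingProb_of_facts`,
`tendsto_triDomainCrossingProb_of_crossRatio_eq_of_facts`).

## Square-lattice specialisation of universality (crit-perc.S23 ⇒ crude crit-perc.S01)

The second named fact of `CardyFormula.lean` discharged here is
`hasCrossingLimit_squareLattice_of_cardyUniversality`: the universality conjecture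
`CardyUniversality` (Cardy's formula for the canonical bond percolation of every isoradial graph
in Grimmett–Manolescu's class `𝒢`) implies Cardy's formula for bond percolation on `ℤ²` at
`p = 1/2` in the crude discretisation `embDomainCrossing`.

* `hasCrossingLimit_squareLattice_of_cardyUniversality_holds` — PROVED.

The statement file already reduces the fact to its six-member trust base
(`hasCrossingLimit_squareLattice_of_cardyUniversality_of_squareLatticeFacts`): `ℤ²` with its
isoradial embedding `squareLatticeEmbedding` lies in `𝒢` and its canonical law is `P_{1/2}`.
All six members are discharged elsewhere in `Literature`, sorry-free:
`zdGraph_preconnected_holds` (`LatticeModels/LatticeGraph`: `ℤ^d` is preconnected);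
`isIsoradial_squareLatticeEmbedding_holds`, `hasBoundedAngles_squareLatticeEmbedding_holds`
(`BAP(ε)` for `ε ≤ π/4`) and `hasSquareGridProperty_squareLattice_holds`
(`LatticeModels/IsoradialGraphsProofs`); `RhombicEmbedding.isoradialPercolation_squareLattice_holds`
(`LatticeModels/IsoradialPercolationProofs`: all canonical weights of the isotropic square
lattice are `1/2`, so the canonical law is `bondPercolation (zdGraph 2) half`); and
`isRhombicTiling_squareLatticeEmbedding_holds` (`Percolation/IsoradialProofs`). This file only
assembles them (import `Percolation/IsoradialProofs`); it is kept out of the statement file so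
that the latter's import closure (several `Summits/…/Statement.lean`) does not grow.

Source check: Grimmett–Manolescu (2014), §1 (arXiv:1204.0505v3, pp. 2–3: "The class `𝒢`
includes many specific models studied earlier"; §1 and §4.6: an isoradial square lattice is an
isoradial embedding of `ℤ²`, the isotropic one having all edge-parameters `p_e = 1/2`);
Grimmett, Proc. ICM 2014, §5(B) (Cardy's formula conjectured for the canonical percolation
measure of isoradial graphs). The discharged statement is the corollary "conjecture ⇒ its `ℤ²`
instance"; no numbered result of the sources is used beyond the membership `ℤ² ∈ 𝒢`.

## References

* S. Smirnov, *Critical percolation in the plane: conformal invariance, Cardy's formula, scaling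
  limits*, C. R. Acad. Sci. Paris Sér. I Math. 333 (2001) 239–244, Thm. 1 and Cor.; long
  version arXiv:0909.4499, Thm. 1, Cor. 1–3 (p. 5).
* B. Bollobás, O. Riordan, *Percolation*, Cambridge Univ. Press (2006), Ch. 7: p. 161
  (cross-ratio classifies 4-marked domains), Thm. 2 (p. 165), proof pp. 202–203.
* G. R. Grimmett, I. Manolescu, *Bond percolation on isoradial graphs: criticality and
  universality*, Probab. Theory Related Fields 159 (2014) 273–327, §1, §2.1, §4.6
  (bib key `GrimmettManolescu2014`).
* G. R. Grimmett, *Criticality, universality, and isoradiality*, Proc. ICM Seoul 2014,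
  vol. IV, 25–48, §5(B) (bib key `Grimmett2014ICM`).
-/

noncomputable section

open Set Filter Topology

namespace Literature.Probability.Percolation

open LatticeModels

/-- **crit-perc.S03 from (D′) alone**: Cardy's formula for critical site percolation on `δ𝕋`
(Smirnov 2001, Thm. 1; Bollobás–Riordan 2006, Ch. 7, Thm. 2, p. 165) follows from the discrete
separating data `smirnov_exists_separatingData`, the Jordan curve theorem hypothesis of
`hasCrossingLimit_triDomainCrossingProb_of_separatingFamilies` being discharged by
`JordanCurveTheorem_holds`. [cite: BollobasRiordan2006, Ch. 7 Thm. 2 (p. 165)] -/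
theorem hasCrossingLimit_triDomainCrossingProb_of_separatingData
    (hD : smirnov_exists_separatingData) : hasCrossingLimit_triDomainCrossingProb :=
  hasCrossingLimit_triDomainCrossingProb_of_separatingFamilies
    (smirnov_exists_separatingFamilies_of_separatingData hD) Literature.Topology.PlaneTopology.JordanCurveTheorem_holds

/-- **Existence of the scaling limit of the crossing probability from (D′) alone** (first half
of Bollobás–Riordan 2006, Ch. 7, Thm. 2, p. 165: "`P(D₄) = lim_{δ→0} P_δ(D₄, T)` exists"), the
limit lying in `[0, 1]`. [cite: BollobasRiordan2006, Ch. 7 Thm. 2 (p. 165)] -/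
theorem exists_tendsto_triDomainCrossingProb_of_separatingData
    (hD : smirnov_exists_separatingData) (R : RandomPlanarGeometry.ConformalRectangle) :
    ∃ L ∈ Icc (0 : ℝ) 1, Tendsto (triDomainCrossingProb R) (𝓝[>] 0) (𝓝 L) :=
  exists_tendsto_triDomainCrossingProb_of_separatingFamilies
    (smirnov_exists_separatingFamilies_of_separatingData hD) Literature.Topology.PlaneTopology.JordanCurveTheorem_holds R

/-- **Conformal invariance of the crossing limit from (D′) alone**: the named fact
`tendsto_triDomainCrossingProb_of_crossRatio_eq` (Smirnov, C. R. Acad. Sci. 333 (2001), Thm. 1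
and Cor.; arXiv:0909.4499, Cor. 2: "as `δ → 0`, the crossing probability tends to `h_{τ²}(x)`,
and hence is conformally invariant"; Bollobás–Riordan 2006, Ch. 7, Thm. 2 with p. 161) follows
from the discrete separating data (D′) `smirnov_exists_separatingData`: both limits are `F(η)`
for the common cross-ratio `η` (`tendsto_triDomainCrossingProb_of_crossRatio_eq_of_hasCrossingLimit`).
[cite: Smirnov2001, Thm. 1 and Cor.] [cite: BollobasRiordan2006, Ch. 7 Thm. 2 (p. 165)] -/
theorem tendsto_triDomainCrossingProb_of_crossRatio_eq_of_separatingData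
    (hD : smirnov_exists_separatingData) : tendsto_triDomainCrossingProb_of_crossRatio_eq :=
  tendsto_triDomainCrossingProb_of_crossRatio_eq_of_hasCrossingLimit
    (hasCrossingLimit_triDomainCrossingProb_of_separatingData hD)

/-! ### The current frontier: crit-perc.S03 and the conformal invariance of the crossing limit
from the five remaining named facts of the discrete theory -/

/-- **Lemma 13 (`tri_discreteCauchy`) from Claim 10 and Lemma 12 alone**, Lemma 4 being proved
(`tri_annulusCrossing_bound_holds`). [cite: BollobasRiordan2006, Ch. 7 Lemma 13 p. 181] -/
theorem tri_discreteCauchy_of_subset_arms_of_rotate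
    (harms : tri_sepEvent_diff_subset_arms) (hrot : tri_sepDiffProb_rotate) : tri_discreteCauchy :=
  tri_discreteCauchy_of_facts tri_annulusCrossing_bound_holds harms hrot

/-- **The estimate of the proof of Claim 22 (`tri_sepProb_sub_le_of_dualPath`) from Claim 10
alone**, Lemma 4 being proved (cf. the conditional discharges
`tri_sepProb_sub_le_of_dualPath_of_facts` of `SmirnovDiscreteCauchy.lean` and
`tri_sepProb_sub_le_of_dualPath_of_arms` of `TriSepProbEstimates.lean`). [cite: BollobasRiordan2006, Ch. 7 proof of Claim 22 p. 198] -/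
theorem tri_sepProb_sub_le_of_dualPath_of_subset_arms
    (harms : tri_sepEvent_diff_subset_arms) : tri_sepProb_sub_le_of_dualPath :=
  tri_sepProb_sub_le_of_dualPath_of_facts tri_annulusCrossing_bound_holds harms

/-- **(D′) `smirnov_exists_separatingData` from the five remaining named facts** of the discrete
theory of Bollobás–Riordan 2006, Ch. 7: Lemma 14 with (19) (`tri_exists_discreteApprox`), (40)
(`tri_openCrossingProb_approx_sepProb`), the estimates of the proof of Claim 23
(`tri_sepProb_boundary_tendsto`), Claim 10 (`tri_sepEvent_diff_subset_arms`) and Lemma 12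
(`tri_sepDiffProb_rotate`) — the anticlockwise case by `smirnov_separatingData_of_discreteApprox`
with Lemma 13 and the estimate of Claim 22 discharged from Claim 10, Lemma 12 and the proved
Lemma 4, the clockwise case by complex conjugation
(`smirnov_exists_separatingData_of_anticlockwise`). [cite: BollobasRiordan2006, Ch. 7 §7.2.6 pp. 196–203] -/
theorem smirnov_exists_separatingData_of_facts (h14 : tri_exists_discreteApprox)
    (h40 : tri_openCrossingProb_approx_sepProb) (h200 : tri_sepProb_boundary_tendsto)
    (harms : tri_sepEvent_diff_subset_arms) (hrot : tri_sepDiffProb_rotate) :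
    smirnov_exists_separatingData :=
  smirnov_exists_separatingData_of_anticlockwise fun R a b c d ψ habc hd hψ hacw =>
    smirnov_separatingData_of_discreteApprox h14
      (tri_discreteCauchy_of_subset_arms_of_rotate harms hrot)
      (tri_sepProb_sub_le_of_dualPath_of_subset_arms harms) h200 h40 R a b c d ψ habc hd hψ hacw

/-- **crit-perc.S03 (Smirnov's theorem / Cardy's formula, `hasCrossingLimit_triDomainCrossingProb`)
from the five remaining named facts.** [cite: BollobasRiordan2006, Ch. 7 Thm. 2 (p. 165)] -/
theorem hasCrossingLimit_triDomainCrossingProb_of_facts (h14 : tri_exists_discreteApprox)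
    (h40 : tri_openCrossingProb_approx_sepProb) (h200 : tri_sepProb_boundary_tendsto)
    (harms : tri_sepEvent_diff_subset_arms) (hrot : tri_sepDiffProb_rotate) :
    hasCrossingLimit_triDomainCrossingProb :=
  hasCrossingLimit_triDomainCrossingProb_of_separatingData
    (smirnov_exists_separatingData_of_facts h14 h40 h200 harms hrot)

/-- **The conformal invariance of the crossing limit
(`tendsto_triDomainCrossingProb_of_crossRatio_eq`) from the five remaining named facts.**
[cite: Smirnov2001, Thm. 1 and Cor.] [cite: BollobasRiordan2006, Ch. 7 Thm. 2 (p. 165)] -/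
theorem tendsto_triDomainCrossingProb_of_crossRatio_eq_of_facts (h14 : tri_exists_discreteApprox)
    (h40 : tri_openCrossingProb_approx_sepProb) (h200 : tri_sepProb_boundary_tendsto)
    (harms : tri_sepEvent_diff_subset_arms) (hrot : tri_sepDiffProb_rotate) :
    tendsto_triDomainCrossingProb_of_crossRatio_eq :=
  tendsto_triDomainCrossingProb_of_crossRatio_eq_of_separatingData
    (smirnov_exists_separatingData_of_facts h14 h40 h200 harms hrot)

/-! ### Square-lattice specialisation of `CardyUniversality` -/

/-- **Discharge of `hasCrossingLimit_squareLattice_of_cardyUniversality`** (crit-perc.S23 ⇒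
crude crit-perc.S01): assuming the universality conjecture `CardyUniversality`, the
`P_{1/2}`-probability of an open crossing (`embDomainCrossing`) of any conformal rectangle
`(Ω; a, b, c, d)` in `δℤ²` from `(ab)` to `(cd)` converges to `cardyFunction η` as `δ → 0⁺`.
Obtained from the in-file reduction
`hasCrossingLimit_squareLattice_of_cardyUniversality_of_squareLatticeFacts` of the statement
file fed with the six discharged square-lattice instance facts `zdGraph_preconnected_holds`,
`isIsoradial_squareLatticeEmbedding_holds`, `isRhombicTiling_squareLatticeEmbedding_holds`,
`hasSquareGridProperty_squareLattice_holds`, `hasBoundedAngles_squareLatticeEmbedding_holds`,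
`RhombicEmbedding.isoradialPercolation_squareLattice_holds`.
(Grimmett–Manolescu, PTRF 159 (2014), §1: the class `𝒢` includes `ℤ²`, whose canonical
measure is `P_{1/2}`; Grimmett, Proc. ICM 2014, §5(B).) [cite: GrimmettManolescu2014, §1] -/
theorem hasCrossingLimit_squareLattice_of_cardyUniversality_holds :
    hasCrossingLimit_squareLattice_of_cardyUniversality :=
  hasCrossingLimit_squareLattice_of_cardyUniversality_of_squareLatticeFacts
    zdGraph_preconnected_holds isIsoradial_squareLatticeEmbedding_holds
    isRhombicTiling_squareLatticeEmbedding_holds hasSquareGridProperty_squareLattice_holds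
    hasBoundedAngles_squareLatticeEmbedding_holds
    RhombicEmbedding.isoradialPercolation_squareLattice_holds

/-- Unconditional form of the discharged fact, for users who want the conclusion directly:
`CardyUniversality` implies Cardy's formula on `ℤ²` (crude discretisation) for every conformal
rectangle. (Grimmett–Manolescu 2014, §1; Grimmett, Proc. ICM 2014, §5(B).)
[cite: GrimmettManolescu2014, §1] -/
theorem hasCrossingLimit_squareLattice_of_cardyUniversality' (h : CardyUniversality)
    (R : RandomPlanarGeometry.ConformalRectangle) :
    R.HasCrossingLimit
      (fun δ ↦ (bondPercolation (zdGraph 2) half).real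
        (embDomainCrossing squareLatticeEmbedding.z R.carrier δ (R.arc 0) (R.arc 2)))
      cardyFunction :=
  hasCrossingLimit_squareLattice_of_cardyUniversality_holds h R

end Literature.Probability.Percolation

end
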